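import Summits.CriticalPhenomena.PercolationContinuityZ3.Theorems.PercNearOneGluingNoHeavyLowerTailMonotonePolarizedStrongHarris
import Literature.Probability.Percolation.StrongHarrisThreePoint
import Mathlib.Tactic.Ring
import Mathlib.Tactic.Linarith
import HarnessLib

/-!
# Chain polarization of 3PT-LB (= SHK3⁺ = Sahi's `E₃` on the three pairwise separations): reduction to the chain-polarized
# Aas–Gladkov-plus form, the `t·AG` part being nonnegative by the monotone polarized strong Harris inequality

Support file (prover prim-l12-p6 gen 18; `--supports stmt-CriticalPhenomena-4575`).  No definitions, no named facts, no sorries.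

Context.  CONJECTURE MP (prim-e3grp-switch-3 g2, INEQ-CLAIMS l.867; = gen-17's "MPC" of this lineage): along a chain of edge weights
`w₃ ≤ w₂ ≤ w₁` the symmetric trilinear polarization of each cubic three-point row is `≥ 0`.  Its quadratic case — the POLARIZED
AAS–GLADKOV inequality `q t' + q' t ≥ Σ_{x≠z} u_x u'_z` — is the tree theorem
`prodBernoulli_polarized_strongHarris_sunflower_three` (switch-3, file `…MonotonePolarizedStrongHarris`).
Here, for the row 3PT-LB `E₃({a↮b},{a↮c},{b↮c}) = (1+t)(qt − e₂(u)) − e₃(u) = AG⁺ + t·AG`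
(`Literature.Probability.Percolation.prodBernoulli_sahiE3_pairSep_eq`), we record in the kernel:
* `six_polar_pairSep_eq` — the exact identity of tri-affine forms (pure algebra in the masses `x_k = μ_k(a↔b)`, `y_k = μ_k(a↔c)`,
  `z_k = μ_k(b↔c)`, `t_k = μ_k(abc)` of three laws): `6·T_F(μ₁,μ₂,μ₃) = 6·T_{AG⁺}(μ₁,μ₂,μ₃) + Σ_ℓ t_ℓ · P(the other two)`, where `T_F` is the
  polarized `E₃` of the pairwise separations, `T_{AG⁺}` the polarization of `q t − e₂(u) − e₃(u)`, and `P(j,k) = q_j t_k + q_k t_j − Σ_{x≠z}u^j_x u^k_z`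
  the polarized Aas–Gladkov form;
* `polar_tAG_nonneg` — for `prodBernoulli w_k` with `w₃ ≤ w₂ ≤ w₁` the term `Σ_ℓ t_ℓ·P(j,k)` is `≥ 0` (three uses of the polarized Aas–Gladkov
  theorem: every pair of a chain is comparable);
* `polar_pairSep_ge_polar_agplus` — hence the chain-polarized 3PT-LB form dominates the chain-polarized AG⁺ form (unconditional), and
  `polar_pairSep_nonneg_of_polar_agplus` — MP(3PT-LB) for a chain follows from MP(AG⁺) for the same chain (the reduction
  "BCP**(AG⁺-shape) ⇒ BCP**(3PT-LB)" of switch-3's memo §2d(iv), at the level of measures).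
Memo: run/shared/lean/prim/prim-l12/FROM-prim-l12-p6-g18-MPC-3PTLB-STRUCTURE.md.
-/

noncomputable section

namespace Summit.CriticalPhenomena.PercolationContinuityZ3.Theorems

namespace PolarizedThreePointLB

open MeasureTheory Literature.Probability.Percolation Literature.Probability.LatticeModels

/-! ### The algebraic identity -/

/-- **`6·T_F = 6·T_{AG⁺} + Σ_ℓ t_ℓ·P(j,k)`** as an identity of polynomials in the twelve masses `x_k = μ_k(a↔b)`, `y_k = μ_k(a↔c)`,
`z_k = μ_k(b↔c)`, `t_k = μ_k(abc)` (`k = 1,2,3`); cells: `q_k = 1 − x_k − y_k − z_k + 2t_k`, `u^k = (x_k − t_k, y_k − t_k, z_k − t_k)`;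
separation events: `μ_k(a↮b) = 1 − x_k`, `μ_k(a↮b, a↮c) = 1 − x_k − y_k + t_k`, … .  Left side: `Σ_{σ∈S₃}` of
`2μ_{σ1}(ABC) + μ_{σ1}(A)μ_{σ2}(B)μ_{σ3}(C) − μ_{σ1}(A)μ_{σ2}(BC) − μ_{σ1}(B)μ_{σ2}(AC) − μ_{σ1}(C)μ_{σ2}(AB)` for `A,B,C` the three pairwise
separations. [this work] -/
theorem six_polar_pairSep_eq (x₁ y₁ z₁ t₁ x₂ y₂ z₂ t₂ x₃ y₃ z₃ t₃ : ℝ) :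
    ((2 * (1 - x₁ - y₁ - z₁ + 2 * t₁) + (1 - x₁) * (1 - y₂) * (1 - z₃) - (1 - x₁) * (1 - y₂ - z₂ + t₂) - (1 - y₁) * (1 - x₂ - z₂ + t₂) -
          (1 - z₁) * (1 - x₂ - y₂ + t₂)) +
        (2 * (1 - x₁ - y₁ - z₁ + 2 * t₁) + (1 - x₁) * (1 - y₃) * (1 - z₂) - (1 - x₁) * (1 - y₃ - z₃ + t₃) - (1 - y₁) * (1 - x₃ - z₃ + t₃) -
          (1 - z₁) * (1 - x₃ - y₃ + t₃)) +
        (2 * (1 - x₂ - y₂ - z₂ + 2 * t₂) + (1 - x₂) * (1 - y₁) * (1 - z₃) - (1 - x₂) * (1 - y₁ - z₁ + t₁) - (1 - y₂) * (1 - x₁ - z₁ + t₁) -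
          (1 - z₂) * (1 - x₁ - y₁ + t₁)) +
        (2 * (1 - x₂ - y₂ - z₂ + 2 * t₂) + (1 - x₂) * (1 - y₃) * (1 - z₁) - (1 - x₂) * (1 - y₃ - z₃ + t₃) - (1 - y₂) * (1 - x₃ - z₃ + t₃) -
          (1 - z₂) * (1 - x₃ - y₃ + t₃)) +
        (2 * (1 - x₃ - y₃ - z₃ + 2 * t₃) + (1 - x₃) * (1 - y₁) * (1 - z₂) - (1 - x₃) * (1 - y₁ - z₁ + t₁) - (1 - y₃) * (1 - x₁ - z₁ + t₁) -
          (1 - z₃) * (1 - x₁ - y₁ + t₁)) +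
        (2 * (1 - x₃ - y₃ - z₃ + 2 * t₃) + (1 - x₃) * (1 - y₂) * (1 - z₁) - (1 - x₃) * (1 - y₂ - z₂ + t₂) - (1 - y₃) * (1 - x₂ - z₂ + t₂) -
          (1 - z₃) * (1 - x₂ - y₂ + t₂))) =
      (((1 - x₁ - y₁ - z₁ + 2 * t₁) * t₂ + (1 - x₂ - y₂ - z₂ + 2 * t₂) * t₁ + (1 - x₁ - y₁ - z₁ + 2 * t₁) * t₃ +
              (1 - x₃ - y₃ - z₃ + 2 * t₃) * t₁ + (1 - x₂ - y₂ - z₂ + 2 * t₂) * t₃ + (1 - x₃ - y₃ - z₃ + 2 * t₃) * t₂) -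
            (((x₁ - t₁) * (y₂ - t₂) + (x₁ - t₁) * (z₂ - t₂) + (y₁ - t₁) * (z₂ - t₂)) +
              ((x₂ - t₂) * (y₁ - t₁) + (x₂ - t₂) * (z₁ - t₁) + (y₂ - t₂) * (z₁ - t₁)) +
              ((x₁ - t₁) * (y₃ - t₃) + (x₁ - t₁) * (z₃ - t₃) + (y₁ - t₁) * (z₃ - t₃)) +
              ((x₃ - t₃) * (y₁ - t₁) + (x₃ - t₃) * (z₁ - t₁) + (y₃ - t₃) * (z₁ - t₁)) +
              ((x₂ - t₂) * (y₃ - t₃) + (x₂ - t₂) * (z₃ - t₃) + (y₂ - t₂) * (z₃ - t₃)) +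
              ((x₃ - t₃) * (y₂ - t₂) + (x₃ - t₃) * (z₂ - t₂) + (y₃ - t₃) * (z₂ - t₂))) -
          ((x₁ - t₁) * (y₂ - t₂) * (z₃ - t₃) + (x₁ - t₁) * (y₃ - t₃) * (z₂ - t₂) + (x₂ - t₂) * (y₁ - t₁) * (z₃ - t₃) +
            (x₂ - t₂) * (y₃ - t₃) * (z₁ - t₁) + (x₃ - t₃) * (y₁ - t₁) * (z₂ - t₂) + (x₃ - t₃) * (y₂ - t₂) * (z₁ - t₁))) +
        (t₁ *
            ((1 - x₂ - y₂ - z₂ + 2 * t₂) * t₃ + (1 - x₃ - y₃ - z₃ + 2 * t₃) * t₂ -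
              ((x₂ - t₂) * (y₃ - t₃) + (x₃ - t₃) * (y₂ - t₂) + (x₂ - t₂) * (z₃ - t₃) + (x₃ - t₃) * (z₂ - t₂) + (y₂ - t₂) * (z₃ - t₃) +
                (y₃ - t₃) * (z₂ - t₂))) +
          t₂ *
            ((1 - x₁ - y₁ - z₁ + 2 * t₁) * t₃ + (1 - x₃ - y₃ - z₃ + 2 * t₃) * t₁ -
              ((x₁ - t₁) * (y₃ - t₃) + (x₃ - t₃) * (y₁ - t₁) + (x₁ - t₁) * (z₃ - t₃) + (x₃ - t₃) * (z₁ - t₁) + (y₁ - t₁) * (z₃ - t₃) +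
                (y₃ - t₃) * (z₁ - t₁))) +
          t₃ *
            ((1 - x₁ - y₁ - z₁ + 2 * t₁) * t₂ + (1 - x₂ - y₂ - z₂ + 2 * t₂) * t₁ -
              ((x₁ - t₁) * (y₂ - t₂) + (x₂ - t₂) * (y₁ - t₁) + (x₁ - t₁) * (z₂ - t₂) + (x₂ - t₂) * (z₁ - t₁) + (y₁ - t₁) * (z₂ - t₂) +
                (y₂ - t₂) * (z₁ - t₁)))) := by
  ring

/-! ### The cells of one law in terms of the four connection masses -/

section Cells

variable {V : Type*} [Finite V]

omit [Finite V] in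
/-- `{a↔b} ∩ {b↔c} = {a↔b} ∩ {a↔c}` (transitivity of open connection). [folklore] -/
theorem openConn_inter_ab_bc (a b c : V) :
    (openConn a b ∩ openConn b c : Set (BondConfig V)) = openConn a b ∩ openConn a c := by
  ext ω
  constructor
  · rintro ⟨hab, hbc⟩
    exact ⟨hab, SimpleGraph.Reachable.trans hab hbc⟩
  · rintro ⟨hab, hac⟩
    exact ⟨hab, SimpleGraph.Reachable.trans (SimpleGraph.Reachable.symm hab) hac⟩

omit [Finite V] in
/-- `{a↔c} ∩ {b↔c} = {a↔b} ∩ {a↔c}` (transitivity of open connection). [folklore] -/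
theorem openConn_inter_ac_bc (a b c : V) :
    (openConn a c ∩ openConn b c : Set (BondConfig V)) = openConn a b ∩ openConn a c := by
  ext ω
  constructor
  · rintro ⟨hac, hbc⟩
    exact ⟨SimpleGraph.Reachable.trans hac (SimpleGraph.Reachable.symm hbc), hac⟩
  · rintro ⟨hab, hac⟩
    exact ⟨hac, SimpleGraph.Reachable.trans (SimpleGraph.Reachable.symm hab) hac⟩

/-- **The three-point cells of `prodBernoulli w` in the connection masses** `x = μ(a↔b)`, `y = μ(a↔c)`, `z = μ(b↔c)`,
`t = μ({a↔b} ∩ {a↔c})`: the separation events and their intersections, the 'all apart' cell and the three 'one pair' cells.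
(The bookkeeping of `prodBernoulli_sahiE3_pairSep_eq`, isolated.) [folklore] -/
theorem cells_eq (w : Sym2 V → unitInterval) (a b c : V) :
    (prodBernoulli w).real (openConn a b)ᶜ = 1 - (prodBernoulli w).real (openConn a b) ∧
    (prodBernoulli w).real (openConn a c)ᶜ = 1 - (prodBernoulli w).real (openConn a c) ∧
    (prodBernoulli w).real (openConn b c)ᶜ = 1 - (prodBernoulli w).real (openConn b c) ∧
    (prodBernoulli w).real ((openConn a b)ᶜ ∩ (openConn a c)ᶜ) =
        1 - (prodBernoulli w).real (openConn a b) - (prodBernoulli w).real (openConn a c) +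
          (prodBernoulli w).real (openConn a b ∩ openConn a c) ∧
    (prodBernoulli w).real ((openConn a b)ᶜ ∩ (openConn b c)ᶜ) =
        1 - (prodBernoulli w).real (openConn a b) - (prodBernoulli w).real (openConn b c) +
          (prodBernoulli w).real (openConn a b ∩ openConn a c) ∧
    (prodBernoulli w).real ((openConn a c)ᶜ ∩ (openConn b c)ᶜ) =
        1 - (prodBernoulli w).real (openConn a c) - (prodBernoulli w).real (openConn b c) +
          (prodBernoulli w).real (openConn a b ∩ openConn a c) ∧
    (prodBernoulli w).real ((openConn a b)ᶜ ∩ (openConn a c)ᶜ ∩ (openConn b c)ᶜ) =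
        1 - (prodBernoulli w).real (openConn a b) - (prodBernoulli w).real (openConn a c) -
            (prodBernoulli w).real (openConn b c) + 2 * (prodBernoulli w).real (openConn a b ∩ openConn a c) ∧
    (prodBernoulli w).real (openConn a b ∩ (openConn a c)ᶜ) =
        (prodBernoulli w).real (openConn a b) - (prodBernoulli w).real (openConn a b ∩ openConn a c) ∧
    (prodBernoulli w).real (openConn a c ∩ (openConn a b)ᶜ) =
        (prodBernoulli w).real (openConn a c) - (prodBernoulli w).real (openConn a b ∩ openConn a c) ∧
    (prodBernoulli w).real (openConn b c ∩ (openConn a b)ᶜ) =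
        (prodBernoulli w).real (openConn b c) - (prodBernoulli w).real (openConn a b ∩ openConn a c) := by
  classical
  set μ := prodBernoulli w with hμ
  set Eab : Set (BondConfig V) := openConn a b with hEab
  set Eac : Set (BondConfig V) := openConn a c with hEac
  set Ebc : Set (BondConfig V) := openConn b c with hEbc
  have mEab : MeasurableSet Eab := MeasurableSet.of_discrete
  have mEac : MeasurableSet Eac := MeasurableSet.of_discrete
  have mEbc : MeasurableSet Ebc := MeasurableSet.of_discrete
  set T : Set (BondConfig V) := Eab ∩ Eac with hT
  have hT₁ : Eab ∩ Ebc = T := openConn_inter_ab_bc a b c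
  have hT₂ : Eac ∩ Ebc = T := openConn_inter_ac_bc a b c
  set x := μ.real Eab with hx
  set y := μ.real Eac with hy
  set z := μ.real Ebc with hz
  set t := μ.real T with ht
  have hU : μ.real (Eab ∪ Eac) = x + y - t := by
    have h := measureReal_union_add_inter (μ := μ) (s := Eab) mEac
    linarith
  have hU3 : μ.real (Eab ∪ Eac ∪ Ebc) = x + y + z - 2 * t := by
    have h := measureReal_union_add_inter (μ := μ) (s := Eab ∪ Eac) mEbc
    have hI : (Eab ∪ Eac) ∩ Ebc = T := by
      rw [Set.union_inter_distrib_right, hT₁, hT₂, Set.union_self]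
    rw [hI] at h
    linarith
  have cA : μ.real Eabᶜ = 1 - x := probReal_compl_eq_one_sub mEab
  have cB : μ.real Eacᶜ = 1 - y := probReal_compl_eq_one_sub mEac
  have cC : μ.real Ebcᶜ = 1 - z := probReal_compl_eq_one_sub mEbc
  have cAB : μ.real (Eabᶜ ∩ Eacᶜ) = 1 - x - y + t := by
    rw [← Set.compl_union, probReal_compl_eq_one_sub (mEab.union mEac), hU]
    ring
  have cAC : μ.real (Eabᶜ ∩ Ebcᶜ) = 1 - x - z + t := by
    have h := measureReal_union_add_inter (μ := μ) (s := Eab) mEbc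
    rw [hT₁] at h
    rw [← Set.compl_union, probReal_compl_eq_one_sub (mEab.union mEbc)]
    linarith
  have cBC : μ.real (Eacᶜ ∩ Ebcᶜ) = 1 - y - z + t := by
    have h := measureReal_union_add_inter (μ := μ) (s := Eac) mEbc
    rw [hT₂] at h
    rw [← Set.compl_union, probReal_compl_eq_one_sub (mEac.union mEbc)]
    linarith
  have cQ : μ.real (Eabᶜ ∩ Eacᶜ ∩ Ebcᶜ) = 1 - x - y - z + 2 * t := by
    rw [← Set.compl_union, ← Set.compl_union, probReal_compl_eq_one_sub ((mEab.union mEac).union mEbc), hU3]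
    ring
  have u₃ : μ.real (Eab ∩ Eacᶜ) = x - t := by
    have h := measureReal_inter_add_sdiff (μ := μ) (s := Eab) mEac
    rw [Set.sdiff_eq] at h
    linarith
  have u₂ : μ.real (Eac ∩ Eabᶜ) = y - t := by
    have h := measureReal_inter_add_sdiff (μ := μ) (s := Eac) mEab
    rw [Set.sdiff_eq, Set.inter_comm Eac Eab] at h
    linarith
  have u₁ : μ.real (Ebc ∩ Eabᶜ) = z - t := by
    have h := measureReal_inter_add_sdiff (μ := μ) (s := Ebc) mEab
    rw [Set.sdiff_eq, Set.inter_comm Ebc Eab, hT₁] at h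
    linarith
  exact ⟨cA, cB, cC, cAB, cAC, cBC, cQ, u₃, u₂, u₁⟩

/-- **The polarized Aas–Gladkov form of an ordered pair is nonnegative, in the connection masses**: for `w' ≤ w` pointwise,
`0 ≤ q t' + q' t − Σ_{x ≠ z} u_x u'_z` with `q = 1 − x − y − z + 2t`, `u = (x − t, y − t, z − t)` (and primed), a rewriting of
`prodBernoulli_polarized_strongHarris_sunflower_three` (prim-e3grp-switch-3). [this work] -/
theorem polarAG_nonneg (w w' : Sym2 V → unitInterval) (hw : ∀ e, (w' e : ℝ) ≤ w e) (a b c : V) :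
    0 ≤ (1 - (prodBernoulli w).real (openConn a b) - (prodBernoulli w).real (openConn a c) - (prodBernoulli w).real (openConn b c) +
              2 * (prodBernoulli w).real (openConn a b ∩ openConn a c)) *
            (prodBernoulli w').real (openConn a b ∩ openConn a c) +
          (1 - (prodBernoulli w').real (openConn a b) - (prodBernoulli w').real (openConn a c) - (prodBernoulli w').real (openConn b c) +
              2 * (prodBernoulli w').real (openConn a b ∩ openConn a c)) *
            (prodBernoulli w).real (openConn a b ∩ openConn a c) -
        (((prodBernoulli w).real (openConn a b) - (prodBernoulli w).real (openConn a b ∩ openConn a c)) *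
              ((prodBernoulli w').real (openConn a c) - (prodBernoulli w').real (openConn a b ∩ openConn a c)) +
            ((prodBernoulli w').real (openConn a b) - (prodBernoulli w').real (openConn a b ∩ openConn a c)) *
              ((prodBernoulli w).real (openConn a c) - (prodBernoulli w).real (openConn a b ∩ openConn a c)) +
            ((prodBernoulli w).real (openConn a b) - (prodBernoulli w).real (openConn a b ∩ openConn a c)) *
              ((prodBernoulli w').real (openConn b c) - (prodBernoulli w').real (openConn a b ∩ openConn a c)) +
            ((prodBernoulli w').real (openConn a b) - (prodBernoulli w').real (openConn a b ∩ openConn a c)) *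
              ((prodBernoulli w).real (openConn b c) - (prodBernoulli w).real (openConn a b ∩ openConn a c)) +
            ((prodBernoulli w).real (openConn a c) - (prodBernoulli w).real (openConn a b ∩ openConn a c)) *
              ((prodBernoulli w').real (openConn b c) - (prodBernoulli w').real (openConn a b ∩ openConn a c)) +
            ((prodBernoulli w').real (openConn a c) - (prodBernoulli w').real (openConn a b ∩ openConn a c)) *
              ((prodBernoulli w).real (openConn b c) - (prodBernoulli w).real (openConn a b ∩ openConn a c))) := by
  classical
  -- the sunflower {a↔b}, {a↔c}, {b↔c} with core {a↔b} ∩ {a↔c}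
  have h12 : (openConn a b ∩ openConn a c : Set (BondConfig V)) = openConn a b ∩ openConn a c := rfl
  have h13 : (openConn a b ∩ openConn b c : Set (BondConfig V)) = openConn a b ∩ openConn a c := openConn_inter_ab_bc a b c
  have h23 : (openConn a c ∩ openConn b c : Set (BondConfig V)) = openConn a b ∩ openConn a c := openConn_inter_ac_bc a b c
  have key := prodBernoulli_polarized_strongHarris_sunflower_three w w' hw (isUpperSet_openConn a b) (isUpperSet_openConn a c)
    (isUpperSet_openConn b c) h12 h13 h23
  -- rewrite petals and the bottom cell into the cells of `cells_eq`
  have pab : (openConn a b \ (openConn a b ∩ openConn a c) : Set (BondConfig V)) = openConn a b ∩ (openConn a c)ᶜ := by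
    rw [Set.sdiff_self_inter, Set.sdiff_eq]
  have pac : (openConn a c \ (openConn a b ∩ openConn a c) : Set (BondConfig V)) = openConn a c ∩ (openConn a b)ᶜ := by
    rw [Set.inter_comm, Set.sdiff_self_inter, Set.sdiff_eq]
  have pbc : (openConn b c \ (openConn a b ∩ openConn a c) : Set (BondConfig V)) = openConn b c ∩ (openConn a b)ᶜ := by
    rw [← h13, Set.inter_comm, Set.sdiff_self_inter, Set.sdiff_eq]
  have pq : ((openConn a b ∪ openConn a c ∪ openConn b c)ᶜ : Set (BondConfig V)) =
      (openConn a b)ᶜ ∩ (openConn a c)ᶜ ∩ (openConn b c)ᶜ := by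
    rw [Set.compl_union, Set.compl_union]
  rw [pab, pac, pbc, pq] at key
  obtain ⟨-, -, -, -, -, -, cQ, u₃, u₂, u₁⟩ := cells_eq w a b c
  obtain ⟨-, -, -, -, -, -, cQ', u₃', u₂', u₁'⟩ := cells_eq w' a b c
  rw [cQ, u₃, u₂, u₁, cQ', u₃', u₂', u₁'] at key
  linarith

end Cells

/-! ### The reduction at the level of measures -/

section Main

variable {V : Type*} [Finite V]

/-- **The `t·AG` part of the chain-polarized 3PT-LB form is nonnegative**: for three edge-weight functions `w₃ ≤ w₂ ≤ w₁`,
`0 ≤ Σ_ℓ t_ℓ · P(j,k)` (`{j,k}` the other two levels, `P` the polarized Aas–Gladkov form) — every pair of a chain is comparable,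
so `polarAG_nonneg` applies three times. [this work] -/
theorem polar_tAG_nonneg (w₁ w₂ w₃ : Sym2 V → unitInterval) (h₂₁ : ∀ e, (w₂ e : ℝ) ≤ w₁ e) (h₃₂ : ∀ e, (w₃ e : ℝ) ≤ w₂ e)
    (a b c : V) :
    let x₁ := (prodBernoulli w₁).real (openConn a b); let y₁ := (prodBernoulli w₁).real (openConn a c)
    let z₁ := (prodBernoulli w₁).real (openConn b c); let t₁ := (prodBernoulli w₁).real (openConn a b ∩ openConn a c)
    let x₂ := (prodBernoulli w₂).real (openConn a b); let y₂ := (prodBernoulli w₂).real (openConn a c)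
    let z₂ := (prodBernoulli w₂).real (openConn b c); let t₂ := (prodBernoulli w₂).real (openConn a b ∩ openConn a c)
    let x₃ := (prodBernoulli w₃).real (openConn a b); let y₃ := (prodBernoulli w₃).real (openConn a c)
    let z₃ := (prodBernoulli w₃).real (openConn b c); let t₃ := (prodBernoulli w₃).real (openConn a b ∩ openConn a c)
    0 ≤ t₁ *
            ((1 - x₂ - y₂ - z₂ + 2 * t₂) * t₃ + (1 - x₃ - y₃ - z₃ + 2 * t₃) * t₂ -
              ((x₂ - t₂) * (y₃ - t₃) + (x₃ - t₃) * (y₂ - t₂) + (x₂ - t₂) * (z₃ - t₃) + (x₃ - t₃) * (z₂ - t₂) + (y₂ - t₂) * (z₃ - t₃) +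
                (y₃ - t₃) * (z₂ - t₂))) +
          t₂ *
            ((1 - x₁ - y₁ - z₁ + 2 * t₁) * t₃ + (1 - x₃ - y₃ - z₃ + 2 * t₃) * t₁ -
              ((x₁ - t₁) * (y₃ - t₃) + (x₃ - t₃) * (y₁ - t₁) + (x₁ - t₁) * (z₃ - t₃) + (x₃ - t₃) * (z₁ - t₁) + (y₁ - t₁) * (z₃ - t₃) +
                (y₃ - t₃) * (z₁ - t₁))) +
          t₃ *
            ((1 - x₁ - y₁ - z₁ + 2 * t₁) * t₂ + (1 - x₂ - y₂ - z₂ + 2 * t₂) * t₁ -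
              ((x₁ - t₁) * (y₂ - t₂) + (x₂ - t₂) * (y₁ - t₁) + (x₁ - t₁) * (z₂ - t₂) + (x₂ - t₂) * (z₁ - t₁) + (y₁ - t₁) * (z₂ - t₂) +
                (y₂ - t₂) * (z₁ - t₁))) := by
  intro x₁ y₁ z₁ t₁ x₂ y₂ z₂ t₂ x₃ y₃ z₃ t₃
  have h₃₁ : ∀ e, (w₃ e : ℝ) ≤ w₁ e := fun e => (h₃₂ e).trans (h₂₁ e)
  have P23 := polarAG_nonneg w₂ w₃ h₃₂ a b c
  have P13 := polarAG_nonneg w₁ w₃ h₃₁ a b c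
  have P12 := polarAG_nonneg w₁ w₂ h₂₁ a b c
  have ht₁ : 0 ≤ t₁ := measureReal_nonneg
  have ht₂ : 0 ≤ t₂ := measureReal_nonneg
  have ht₃ : 0 ≤ t₃ := measureReal_nonneg
  have e1 := mul_nonneg ht₁ P23
  have e2 := mul_nonneg ht₂ P13
  have e3 := mul_nonneg ht₃ P12
  -- the three products are, up to the order of factors inside, the three summands
  nlinarith [e1, e2, e3]

/-- **Chain-polarized 3PT-LB ≥ chain-polarized AG⁺ (unconditional).**  For `w₃ ≤ w₂ ≤ w₁` and vertices `a,b,c`, with `μ_k = prodBernoulli w_k`,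
`A = {a↮b}`, `B = {a↮c}`, `C = {b↮c}`: the polarized Sahi form `Σ_{σ∈S₃}[2μ_{σ1}(ABC) + μ_{σ1}(A)μ_{σ2}(B)μ_{σ3}(C) − μ_{σ1}(A)μ_{σ2}(BC) −
μ_{σ1}(B)μ_{σ2}(AC) − μ_{σ1}(C)μ_{σ2}(AB)]` is at least the polarization of `q t − e₂(u) − e₃(u)` at `(μ₁,μ₂,μ₃)` (written in the
connection masses). [this work] -/
theorem polar_pairSep_ge_polar_agplus (w₁ w₂ w₃ : Sym2 V → unitInterval) (h₂₁ : ∀ e, (w₂ e : ℝ) ≤ w₁ e) (h₃₂ : ∀ e, (w₃ e : ℝ) ≤ w₂ e)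
    (a b c : V) :
    let μ₁ := prodBernoulli w₁; let μ₂ := prodBernoulli w₂; let μ₃ := prodBernoulli w₃
    let A : Set (BondConfig V) := (openConn a b)ᶜ; let B : Set (BondConfig V) := (openConn a c)ᶜ; let C : Set (BondConfig V) := (openConn b c)ᶜ
    let x₁ := μ₁.real (openConn a b); let y₁ := μ₁.real (openConn a c); let z₁ := μ₁.real (openConn b c); let t₁ := μ₁.real (openConn a b ∩ openConn a c)
    let x₂ := μ₂.real (openConn a b); let y₂ := μ₂.real (openConn a c); let z₂ := μ₂.real (openConn b c); let t₂ := μ₂.real (openConn a b ∩ openConn a c)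
    let x₃ := μ₃.real (openConn a b); let y₃ := μ₃.real (openConn a c); let z₃ := μ₃.real (openConn b c); let t₃ := μ₃.real (openConn a b ∩ openConn a c)
    (((1 - x₁ - y₁ - z₁ + 2 * t₁) * t₂ + (1 - x₂ - y₂ - z₂ + 2 * t₂) * t₁ + (1 - x₁ - y₁ - z₁ + 2 * t₁) * t₃ +
              (1 - x₃ - y₃ - z₃ + 2 * t₃) * t₁ + (1 - x₂ - y₂ - z₂ + 2 * t₂) * t₃ + (1 - x₃ - y₃ - z₃ + 2 * t₃) * t₂) -
            (((x₁ - t₁) * (y₂ - t₂) + (x₁ - t₁) * (z₂ - t₂) + (y₁ - t₁) * (z₂ - t₂)) +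
              ((x₂ - t₂) * (y₁ - t₁) + (x₂ - t₂) * (z₁ - t₁) + (y₂ - t₂) * (z₁ - t₁)) +
              ((x₁ - t₁) * (y₃ - t₃) + (x₁ - t₁) * (z₃ - t₃) + (y₁ - t₁) * (z₃ - t₃)) +
              ((x₃ - t₃) * (y₁ - t₁) + (x₃ - t₃) * (z₁ - t₁) + (y₃ - t₃) * (z₁ - t₁)) +
              ((x₂ - t₂) * (y₃ - t₃) + (x₂ - t₂) * (z₃ - t₃) + (y₂ - t₂) * (z₃ - t₃)) +
              ((x₃ - t₃) * (y₂ - t₂) + (x₃ - t₃) * (z₂ - t₂) + (y₃ - t₃) * (z₂ - t₂))) -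
          ((x₁ - t₁) * (y₂ - t₂) * (z₃ - t₃) + (x₁ - t₁) * (y₃ - t₃) * (z₂ - t₂) + (x₂ - t₂) * (y₁ - t₁) * (z₃ - t₃) +
            (x₂ - t₂) * (y₃ - t₃) * (z₁ - t₁) + (x₃ - t₃) * (y₁ - t₁) * (z₂ - t₂) + (x₃ - t₃) * (y₂ - t₂) * (z₁ - t₁))) ≤
      (2 * μ₁.real (A ∩ B ∩ C) + μ₁.real A * μ₂.real B * μ₃.real C - μ₁.real A * μ₂.real (B ∩ C) - μ₁.real B * μ₂.real (A ∩ C) - μ₁.real C * μ₂.real (A ∩ B)) +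
        (2 * μ₁.real (A ∩ B ∩ C) + μ₁.real A * μ₃.real B * μ₂.real C - μ₁.real A * μ₃.real (B ∩ C) - μ₁.real B * μ₃.real (A ∩ C) - μ₁.real C * μ₃.real (A ∩ B)) +
        (2 * μ₂.real (A ∩ B ∩ C) + μ₂.real A * μ₁.real B * μ₃.real C - μ₂.real A * μ₁.real (B ∩ C) - μ₂.real B * μ₁.real (A ∩ C) - μ₂.real C * μ₁.real (A ∩ B)) +
        (2 * μ₂.real (A ∩ B ∩ C) + μ₂.real A * μ₃.real B * μ₁.real C - μ₂.real A * μ₃.real (B ∩ C) - μ₂.real B * μ₃.real (A ∩ C) - μ₂.real C * μ₃.real (A ∩ B)) +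
        (2 * μ₃.real (A ∩ B ∩ C) + μ₃.real A * μ₁.real B * μ₂.real C - μ₃.real A * μ₁.real (B ∩ C) - μ₃.real B * μ₁.real (A ∩ C) - μ₃.real C * μ₁.real (A ∩ B)) +
        (2 * μ₃.real (A ∩ B ∩ C) + μ₃.real A * μ₂.real B * μ₁.real C - μ₃.real A * μ₂.real (B ∩ C) - μ₃.real B * μ₂.real (A ∩ C) - μ₃.real C * μ₂.real (A ∩ B)) := by
  intro μ₁ μ₂ μ₃ A B C x₁ y₁ z₁ t₁ x₂ y₂ z₂ t₂ x₃ y₃ z₃ t₃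
  have hT := polar_tAG_nonneg w₁ w₂ w₃ h₂₁ h₃₂ a b c
  obtain ⟨cA₁, cB₁, cC₁, cAB₁, cAC₁, cBC₁, cQ₁, -, -, -⟩ := cells_eq w₁ a b c
  obtain ⟨cA₂, cB₂, cC₂, cAB₂, cAC₂, cBC₂, cQ₂, -, -, -⟩ := cells_eq w₂ a b c
  obtain ⟨cA₃, cB₃, cC₃, cAB₃, cAC₃, cBC₃, cQ₃, -, -, -⟩ := cells_eq w₃ a b c
  have hid := six_polar_pairSep_eq x₁ y₁ z₁ t₁ x₂ y₂ z₂ t₂ x₃ y₃ z₃ t₃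
  simp only [μ₁, μ₂, μ₃, A, B, C, x₁, y₁, z₁, t₁, x₂, y₂, z₂, t₂, x₃, y₃, z₃, t₃] at hT hid cA₁ cB₁ cC₁ cAB₁ cAC₁ cBC₁ cQ₁ cA₂ cB₂ cC₂ cAB₂ cAC₂ cBC₂ cQ₂ cA₃ cB₃ cC₃ cAB₃ cAC₃ cBC₃ cQ₃ ⊢
  rw [cA₁, cB₁, cC₁, cAB₁, cAC₁, cBC₁, cQ₁, cA₂, cB₂, cC₂, cAB₂, cAC₂, cBC₂, cQ₂, cA₃, cB₃, cC₃, cAB₃, cAC₃, cBC₃, cQ₃]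
  linarith [hid, hT]

/-- **MP(3PT-LB) for a chain follows from MP(AG⁺) for the same chain** (measure-level form of switch-3's reduction): for `w₃ ≤ w₂ ≤ w₁`, if the
chain-polarized Aas–Gladkov-plus form (in the connection masses) is `≥ 0`, then so is the chain-polarized Sahi form of the three pairwise
separations. [this work] -/
theorem polar_pairSep_nonneg_of_polar_agplus (w₁ w₂ w₃ : Sym2 V → unitInterval) (h₂₁ : ∀ e, (w₂ e : ℝ) ≤ w₁ e) (h₃₂ : ∀ e, (w₃ e : ℝ) ≤ w₂ e)
    (a b c : V)
    (hAG :
      let μ₁ := prodBernoulli w₁; let μ₂ := prodBernoulli w₂; let μ₃ := prodBernoulli w₃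
      let x₁ := μ₁.real (openConn a b); let y₁ := μ₁.real (openConn a c); let z₁ := μ₁.real (openConn b c); let t₁ := μ₁.real (openConn a b ∩ openConn a c)
      let x₂ := μ₂.real (openConn a b); let y₂ := μ₂.real (openConn a c); let z₂ := μ₂.real (openConn b c); let t₂ := μ₂.real (openConn a b ∩ openConn a c)
      let x₃ := μ₃.real (openConn a b); let y₃ := μ₃.real (openConn a c); let z₃ := μ₃.real (openConn b c); let t₃ := μ₃.real (openConn a b ∩ openConn a c)
      0 ≤ ((1 - x₁ - y₁ - z₁ + 2 * t₁) * t₂ + (1 - x₂ - y₂ - z₂ + 2 * t₂) * t₁ + (1 - x₁ - y₁ - z₁ + 2 * t₁) * t₃ +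
              (1 - x₃ - y₃ - z₃ + 2 * t₃) * t₁ + (1 - x₂ - y₂ - z₂ + 2 * t₂) * t₃ + (1 - x₃ - y₃ - z₃ + 2 * t₃) * t₂) -
            (((x₁ - t₁) * (y₂ - t₂) + (x₁ - t₁) * (z₂ - t₂) + (y₁ - t₁) * (z₂ - t₂)) +
              ((x₂ - t₂) * (y₁ - t₁) + (x₂ - t₂) * (z₁ - t₁) + (y₂ - t₂) * (z₁ - t₁)) +
              ((x₁ - t₁) * (y₃ - t₃) + (x₁ - t₁) * (z₃ - t₃) + (y₁ - t₁) * (z₃ - t₃)) +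
              ((x₃ - t₃) * (y₁ - t₁) + (x₃ - t₃) * (z₁ - t₁) + (y₃ - t₃) * (z₁ - t₁)) +
              ((x₂ - t₂) * (y₃ - t₃) + (x₂ - t₂) * (z₃ - t₃) + (y₂ - t₂) * (z₃ - t₃)) +
              ((x₃ - t₃) * (y₂ - t₂) + (x₃ - t₃) * (z₂ - t₂) + (y₃ - t₃) * (z₂ - t₂))) -
          ((x₁ - t₁) * (y₂ - t₂) * (z₃ - t₃) + (x₁ - t₁) * (y₃ - t₃) * (z₂ - t₂) + (x₂ - t₂) * (y₁ - t₁) * (z₃ - t₃) +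
            (x₂ - t₂) * (y₃ - t₃) * (z₁ - t₁) + (x₃ - t₃) * (y₁ - t₁) * (z₂ - t₂) + (x₃ - t₃) * (y₂ - t₂) * (z₁ - t₁))) :
    let μ₁ := prodBernoulli w₁; let μ₂ := prodBernoulli w₂; let μ₃ := prodBernoulli w₃
    let A : Set (BondConfig V) := (openConn a b)ᶜ; let B : Set (BondConfig V) := (openConn a c)ᶜ; let C : Set (BondConfig V) := (openConn b c)ᶜ
    0 ≤ (2 * μ₁.real (A ∩ B ∩ C) + μ₁.real A * μ₂.real B * μ₃.real C - μ₁.real A * μ₂.real (B ∩ C) - μ₁.real B * μ₂.real (A ∩ C) - μ₁.real C * μ₂.real (A ∩ B)) +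
        (2 * μ₁.real (A ∩ B ∩ C) + μ₁.real A * μ₃.real B * μ₂.real C - μ₁.real A * μ₃.real (B ∩ C) - μ₁.real B * μ₃.real (A ∩ C) - μ₁.real C * μ₃.real (A ∩ B)) +
        (2 * μ₂.real (A ∩ B ∩ C) + μ₂.real A * μ₁.real B * μ₃.real C - μ₂.real A * μ₁.real (B ∩ C) - μ₂.real B * μ₁.real (A ∩ C) - μ₂.real C * μ₁.real (A ∩ B)) +
        (2 * μ₂.real (A ∩ B ∩ C) + μ₂.real A * μ₃.real B * μ₁.real C - μ₂.real A * μ₃.real (B ∩ C) - μ₂.real B * μ₃.real (A ∩ C) - μ₂.real C * μ₃.real (A ∩ B)) +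
        (2 * μ₃.real (A ∩ B ∩ C) + μ₃.real A * μ₁.real B * μ₂.real C - μ₃.real A * μ₁.real (B ∩ C) - μ₃.real B * μ₁.real (A ∩ C) - μ₃.real C * μ₁.real (A ∩ B)) +
        (2 * μ₃.real (A ∩ B ∩ C) + μ₃.real A * μ₂.real B * μ₁.real C - μ₃.real A * μ₂.real (B ∩ C) - μ₃.real B * μ₂.real (A ∩ C) - μ₃.real C * μ₂.real (A ∩ B)) := by
  intro μ₁ μ₂ μ₃ A B C
  have h := polar_pairSep_ge_polar_agplus w₁ w₂ w₃ h₂₁ h₃₂ a b c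
  simp only [μ₁, μ₂, μ₃, A, B, C] at h hAG ⊢
  linarith [h, hAG]

end Main

end PolarizedThreePointLB

end Summit.CriticalPhenomena.PercolationContinuityZ3.Theorems

end
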